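import Literature.Probability.Percolation.ZdFourArmQuasiMult
import Literature.Probability.Percolation.ZdFourArmPositivity
import Literature.Probability.Percolation.FourArmGarbanMonotone
import Literature.Probability.Percolation.ZdFourArmAPrioriLowerBound
import Literature.Probability.Percolation.ZdFiveArmLowerBound
import HarnessLib

/-!
# Quasi-multiplicativity of the four-arm probability on `ℤ²`: reduction to well-spaced radii

Topic `Literature/Probability/Percolation`; bond percolation on `ℤ² = Site 2` at `p = 1/2`
(`bondPercolation (zdGraph 2) half`), four alternating arms in the cluster form
`fourArmTwoClusters m n` of `FourArmGarban.lean`. PROOFS ONLY (no definition, no named fact):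
companion of the named fact
`Literature.Probability.Percolation.DuminilCopinManolescuTassion2021_zdFourArm_quasiMult`
(`ZdFourArmQuasiMult.lean`; H. Duminil-Copin, I. Manolescu, V. Tassion, *Planar random-cluster
model: fractal properties of the critical phase*, PTRF 181 (2021), §6.2 Prop. 6.3, right-hand
inequality at `q = 1`, `σ = 1010`: `φ[A_σ(r,ρ)] φ[A_σ(ρ,R)] ≤ C₇ φ[A_σ(r,R)]`).

The printed proof of Prop. 6.3 is one sentence ("the proof follows the same lines as for the
random-cluster model with `q = 2`. We refer to [CheDumHon13] for details"), i.e. Kesten's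
arm-separation theorem at both boundaries of the annulus (Kesten 1987, Lemmas 4–5; Nolin 2008,
Thm. 11 [arXiv 0711.4948: Thm. 10]) followed by the gluing of well-separated arms across one
intermediate annulus of bounded modulus (Kesten 1987, Lemma 6 and (2.43); Nolin 2008, Prop. 12
and Prop. 17 [arXiv Prop. 11, Prop. 16]). That argument yields the inequality for WELL-SPACED
radii `A r ≤ ρ`, `A ρ ≤ R` only; the remaining (bounded-ratio) cases are disposed of by the first
sentence of Nolin's proof of Prop. 17 — "We may assume that `n₂ ≥ 8 n₁`" — using nothing but the
monotonicity of the arm event in its two radii and the a-priori positivity of the arm probability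
at bounded ratio (Nolin 2008, Prop. 14 [arXiv Prop. 13], lower half; for the event at hand the
sibling fact `DuminilCopinManolescuTassion2021_zdFourArm_lowerBound`, DMT 2021 Prop. 6.8). This
file PROVES that bookkeeping for the bond-`ℤ²` cluster-form event, the twin of the tree's site-`𝕋`
`polyArmProb_quasiMult_of_spaced` (`ArmQuasiMultNormalForm.lean`):

* `exists_pos_le_real_fourArmTwoClusters_of_le` — at BOUNDED SCALES `1 ≤ r ≤ R ≤ K` the four-arm
  probability is bounded below (finitely many pairs, each positive by
  `real_fourArmTwoClusters_pos`), so no threshold on the inner radius is ever needed;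
* `exists_pos_le_real_fourArmTwoClusters_of_lowerBound` — bounded-RATIO positivity
  `a ≤ P(𝒜₄(A_{m,N}))`, `1 ≤ m ≤ N ≤ B m`, from `DuminilCopinManolescuTassion2021_zdFourArm_lowerBound`;
* `zdFourArm_quasiMult_of_spaced` — **the normal form**: quasi-multiplicativity along well-spaced
  radii (`1 ≤ r`, `A r ≤ ρ`, `A ρ ≤ R`, any fixed `A ≥ 2`) together with bounded-ratio positivity
  (`m₀ ≤ m ≤ N ≤ A² m`) imply `DuminilCopinManolescuTassion2021_zdFourArm_quasiMult` (all
  `1 ≤ r ≤ ρ ≤ R`);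
* `DuminilCopinManolescuTassion2021_zdFourArm_quasiMult_of_spaced_of_lowerBound` — the same with
  the positivity input discharged from the lower-bound fact.

What is NOT here: the well-spaced case itself, i.e. Kesten's separation of four alternating arms
for bond percolation on `ℤ²` at the outer and at the inner boundary and the gluing step; these are
the hypothesis `hsp` below (stated without threshold on the inner radius `r`, as the separation
arguments act near the boundary of radius `ρ` only).

## References

* H. Duminil-Copin, I. Manolescu, V. Tassion, PTRF 181 (2021) 401–449 = arXiv 2007.14707, §6.2
  Prop. 6.3 and its proof; §6.3 Prop. 6.8 [DuminilCopinManolescuTassion2021].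
* P. Nolin, *Near-critical percolation in two dimensions*, EJP 13 (2008), §4.3 Prop. 14, §4.5
  Prop. 17 and its proof, first sentence; §8.1 (bond percolation on `ℤ²`) [arXiv 0711.4948:
  Prop. 13, Prop. 16] [Nolin2008].
* H. Kesten, *Scaling relations for 2D-percolation*, Comm. Math. Phys. 109 (1987), Lemmas 4–6
  [KestenScalingCMP1987].

Tree: `fourArmTwoClusters` (`FourArmGarban.lean`), `real_fourArmTwoClusters_mono`
(`FourArmGarbanMonotone.lean`), `real_fourArmTwoClusters_pos` (`ZdFourArmPositivity.lean`),
`DuminilCopinManolescuTassion2021_zdFourArm_quasiMult`, `DuminilCopinManolescuTassion2021_zdFourArm_lowerBound`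
(`ZdFourArmQuasiMult.lean`). Mathlib: `Finset.exists_min_image`, `Real.rpow_le_rpow`,
`Real.one_le_rpow_of_pos_of_le_one_of_nonpos`, `Nat` division lemmas.
-/

noncomputable section

namespace Literature.Probability.Percolation

open _root_.MeasureTheory Set LatticeModels

/-! ### Positivity at bounded scales and at bounded ratio -/

/-- **At bounded scales the four-arm probability is bounded below**: for every `K` there is
`a > 0` with `a ≤ P_{1/2}(𝒜₄(A_{r,R}))` for all `1 ≤ r ≤ R ≤ K` (finitely many pairs of radii,
each of positive probability by `real_fourArmTwoClusters_pos`). This is why the inner radius of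
`DuminilCopinManolescuTassion2021_zdFourArm_quasiMult` needs no threshold. [folklore] -/
theorem exists_pos_le_real_fourArmTwoClusters_of_le (K : ℕ) :
    ∃ a : ℝ, 0 < a ∧ ∀ r R : ℕ, 1 ≤ r → r ≤ R → R ≤ K →
      a ≤ (bondPercolation (zdGraph 2) half).real (fourArmTwoClusters r R) := by
  classical
  set s : Finset (ℕ × ℕ) := ((Finset.Icc 1 K) ×ˢ (Finset.Icc 1 K)).filter fun q => q.1 ≤ q.2
    with hs
  by_cases hK : K = 0
  · refine ⟨1, one_pos, fun r R hr hrR hRK => absurd (hr.trans (hrR.trans hRK)) ?_⟩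
    omega
  have hne : s.Nonempty := ⟨(1, 1), by
    rw [hs, Finset.mem_filter, Finset.mem_product, Finset.mem_Icc]
    exact ⟨⟨⟨le_rfl, Nat.one_le_iff_ne_zero.2 hK⟩, ⟨le_rfl, Nat.one_le_iff_ne_zero.2 hK⟩⟩, le_rfl⟩⟩
  obtain ⟨q, hq, hmin⟩ := Finset.exists_min_image s
    (fun q : ℕ × ℕ => (bondPercolation (zdGraph 2) half).real (fourArmTwoClusters q.1 q.2)) hne
  have hq' : 1 ≤ q.1 ∧ q.1 ≤ q.2 := by
    rw [hs, Finset.mem_filter, Finset.mem_product, Finset.mem_Icc, Finset.mem_Icc] at hq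
    exact ⟨hq.1.1.1, hq.2⟩
  refine ⟨(bondPercolation (zdGraph 2) half).real (fourArmTwoClusters q.1 q.2),
    real_fourArmTwoClusters_pos hq'.1 hq'.2, fun r R hr hrR hRK => ?_⟩
  have hmem : (r, R) ∈ s := by
    rw [hs, Finset.mem_filter, Finset.mem_product, Finset.mem_Icc, Finset.mem_Icc]
    exact ⟨⟨⟨hr, hrR.trans hRK⟩, ⟨hr.trans hrR, hRK⟩⟩, hrR⟩
  exact hmin (r, R) hmem

/-- **Bounded-ratio positivity from the four-arm lower bound**: if
`c (r/R)^{2-c} ≤ P_{1/2}(𝒜₄(A_{r,R}))` for all `1 ≤ r ≤ R`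
(`DuminilCopinManolescuTassion2021_zdFourArm_lowerBound`, DMT 2021 Prop. 6.8 at `q = 1`), then
for every ratio `B ≥ 1` there is `a > 0` with `a ≤ P_{1/2}(𝒜₄(A_{m,N}))` whenever
`1 ≤ m ≤ N ≤ B m` (Nolin 2008, Prop. 14, lower half, for this pattern). The constant is
`c · min ((1/B)^{2-c}) 1` (the `min` covers an exponent `2 - c` of either sign).
[cite: Nolin2008, §4.3 Prop. 14, lower bound (arXiv 0711.4948: Prop. 13)] -/
theorem exists_pos_le_real_fourArmTwoClusters_of_lowerBound
    (hlb : DuminilCopinManolescuTassion2021_zdFourArm_lowerBound) {B : ℕ} (hB : 1 ≤ B) :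
    ∃ a : ℝ, 0 < a ∧ ∀ m N : ℕ, 1 ≤ m → m ≤ N → N ≤ B * m →
      a ≤ (bondPercolation (zdGraph 2) half).real (fourArmTwoClusters m N) := by
  obtain ⟨c, hc, h⟩ := hlb
  have hB0 : (0 : ℝ) < B := by exact_mod_cast (show 0 < B by omega)
  have hiB : (0 : ℝ) < 1 / B := by positivity
  refine ⟨c * min ((1 / (B : ℝ)) ^ (2 - c)) 1, by positivity, fun m N hm hmN hNB => ?_⟩
  have hm0 : (0 : ℝ) < m := by exact_mod_cast (show 0 < m by omega)
  have hN0 : (0 : ℝ) < N := by exact_mod_cast (show 0 < N by omega)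
  have hx0 : 0 < (m : ℝ) / N := by positivity
  have hx1 : (m : ℝ) / N ≤ 1 := by
    rw [div_le_one hN0]; exact_mod_cast hmN
  have hxB : 1 / (B : ℝ) ≤ (m : ℝ) / N := by
    rw [div_le_div_iff₀ hB0 hN0, one_mul]
    have hNB' : (N : ℝ) ≤ (B : ℝ) * m := by exact_mod_cast hNB
    linarith [mul_comm (B : ℝ) m]
  refine le_trans ?_ (h m N hm hmN)
  refine mul_le_mul_of_nonneg_left ?_ hc.le
  rcases le_or_gt 0 (2 - c) with hs | hs
  · exact (min_le_left _ _).trans (Real.rpow_le_rpow hiB.le hxB hs)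
  · exact (min_le_right _ _).trans (Real.one_le_rpow_of_pos_of_le_one_of_nonpos hx0 hx1 hs.le)

/-! ### The normal form: well-spaced radii and bounded ratios suffice -/

/-- **Normal form of the four-arm quasi-multiplicativity on `ℤ²`** (Nolin 2008, proof of
Prop. 17 [arXiv 0711.4948: Prop. 16]: "We may assume that `n₂ ≥ 8 n₁`: otherwise … allows to
conclude"; DMT 2021, Prop. 6.3 via Prop. 6.2). Fix a ratio `A ≥ 2`. If
(i) `c · P(𝒜₄(A_{r,ρ})) P(𝒜₄(A_{ρ,R})) ≤ P(𝒜₄(A_{r,R}))` whenever `1 ≤ r`, `A r ≤ ρ`, `A ρ ≤ R`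
(the well-spaced case: separation of the four arms near `∂Λ_ρ` from outside and from inside, then
gluing), and (ii) `a ≤ P(𝒜₄(A_{m,N}))` whenever `m₀ ≤ m ≤ N ≤ A² m` (a-priori positivity at bounded
ratio), then `DuminilCopinManolescuTassion2021_zdFourArm_quasiMult` holds. The four bounded-ratio
cases: if `A r ≤ ρ` but `R < A ρ`, either `A² r ≤ R` and the middle radius is moved down to
`⌊R/A⌋ ≤ ρ` (`P(𝒜₄(A_{r,·}))` is non-increasing, `P(𝒜₄(A_{⌊R/A⌋,R})) ≥ a`), or `R < A² r` and
`P(𝒜₄(A_{r,R})) ≥ a` directly; if `ρ < A r`, either `A² r ≤ R` and the middle radius is moved up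
to `A r` (`P(𝒜₄(A_{·,R}))` is non-decreasing, `P(𝒜₄(A_{r,Ar})) ≥ a`), or `P(𝒜₄(A_{r,R})) ≥ a`
directly; radii below `m₀` are finitely many (`exists_pos_le_real_fourArmTwoClusters_of_le`).
[cite: Nolin2008, §4.5 Prop. 17, proof, first sentence (arXiv 0711.4948: Prop. 16)]
[cite: DuminilCopinManolescuTassion2021, §6.2 Prop. 6.3 (proof via Prop. 6.2)] -/
theorem zdFourArm_quasiMult_of_spaced {A : ℕ} (hA : 2 ≤ A)
    (hbd : ∃ a : ℝ, 0 < a ∧ ∃ m₀ : ℕ, ∀ m N : ℕ, m₀ ≤ m → m ≤ N → N ≤ A * (A * m) →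
      a ≤ (bondPercolation (zdGraph 2) half).real (fourArmTwoClusters m N))
    (hsp : ∃ c : ℝ, 0 < c ∧ ∀ r ρ R : ℕ, 1 ≤ r → A * r ≤ ρ → A * ρ ≤ R →
      c * ((bondPercolation (zdGraph 2) half).real (fourArmTwoClusters r ρ) *
          (bondPercolation (zdGraph 2) half).real (fourArmTwoClusters ρ R)) ≤
        (bondPercolation (zdGraph 2) half).real (fourArmTwoClusters r R)) :
    DuminilCopinManolescuTassion2021_zdFourArm_quasiMult := by
  obtain ⟨a, ha, m₀, hbd⟩ := hbd
  obtain ⟨c, hc, hsp⟩ := hsp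
  set P := bondPercolation (zdGraph 2) half with hP
  -- bounded-ratio positivity for ALL `m ≥ 1`: below `m₀` the scales are bounded by `A² m₀`
  obtain ⟨a₀, ha₀, hsmall⟩ := exists_pos_le_real_fourArmTwoClusters_of_le (A * (A * m₀))
  set a₁ : ℝ := min (min a a₀) 1 with ha₁
  have ha₁0 : 0 < a₁ := lt_min (lt_min ha ha₀) one_pos
  have ha₁1 : a₁ ≤ 1 := min_le_right _ _
  have hbd' : ∀ m N : ℕ, 1 ≤ m → m ≤ N → N ≤ A * (A * m) →
      a₁ ≤ P.real (fourArmTwoClusters m N) := by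
    intro m N hm hmN hN
    rcases le_or_gt m₀ m with hm₀ | hm₀
    · exact ((min_le_left _ _).trans (min_le_left _ _)).trans (hbd m N hm₀ hmN hN)
    · refine ((min_le_left _ _).trans (min_le_right _ _)).trans (hsmall m N hm hmN ?_)
      exact hN.trans (Nat.mul_le_mul_left _ (Nat.mul_le_mul_left _ hm₀.le))
  set c₁ : ℝ := min c 1 with hc₁
  have hc₁0 : 0 < c₁ := lt_min hc one_pos
  have hc₁c : c₁ ≤ c := min_le_left _ _
  have hc₁1 : c₁ ≤ 1 := min_le_right _ _
  have hA0 : 0 < A := by omega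
  -- notation-free shorthands for the three probabilities
  have X0 : ∀ m n : ℕ, 0 ≤ P.real (fourArmTwoClusters m n) := fun _ _ => measureReal_nonneg
  have X1 : ∀ m n : ℕ, P.real (fourArmTwoClusters m n) ≤ 1 := fun _ _ => measureReal_le_one
  -- the key inequality with the constant on the left
  have key : ∀ r ρ R : ℕ, 1 ≤ r → r ≤ ρ → ρ ≤ R →
      c₁ * a₁ * (P.real (fourArmTwoClusters r ρ) * P.real (fourArmTwoClusters ρ R)) ≤
        P.real (fourArmTwoClusters r R) := by
    intro r ρ R hr hrρ hρR
    have hprod0 : 0 ≤ P.real (fourArmTwoClusters r ρ) * P.real (fourArmTwoClusters ρ R) :=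
      mul_nonneg (X0 _ _) (X0 _ _)
    have hprod1 : P.real (fourArmTwoClusters r ρ) * P.real (fourArmTwoClusters ρ R) ≤ 1 :=
      mul_le_one₀ (X1 _ _) (X0 _ _) (X1 _ _)
    -- the bounded-ratio conclusion `c₁ a₁ X X ≤ a₁ ≤ X(r, R)` when `R ≤ A² r`
    have direct : R ≤ A * (A * r) →
        c₁ * a₁ * (P.real (fourArmTwoClusters r ρ) * P.real (fourArmTwoClusters ρ R)) ≤
          P.real (fourArmTwoClusters r R) := by
      intro h3
      calc c₁ * a₁ * (P.real (fourArmTwoClusters r ρ) * P.real (fourArmTwoClusters ρ R))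
          ≤ c₁ * a₁ := mul_le_of_le_one_right (by positivity) hprod1
        _ ≤ 1 * a₁ := mul_le_mul_of_nonneg_right hc₁1 ha₁0.le
        _ = a₁ := one_mul _
        _ ≤ P.real (fourArmTwoClusters r R) := hbd' r R hr (hrρ.trans hρR) h3
    rcases le_or_gt (A * (A * r)) R with h3 | h3
    swap
    · exact direct h3.le
    -- from now on `A² r ≤ R`
    rcases le_or_gt (A * r) ρ with h₁₂ | h₁₂
    · rcases le_or_gt (A * ρ) R with h₂₃ | h₂₃
      · -- the well-spaced case
        calc c₁ * a₁ * (P.real (fourArmTwoClusters r ρ) * P.real (fourArmTwoClusters ρ R))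
            ≤ c * 1 * (P.real (fourArmTwoClusters r ρ) * P.real (fourArmTwoClusters ρ R)) :=
              mul_le_mul_of_nonneg_right (mul_le_mul hc₁c ha₁1 ha₁0.le hc.le) hprod0
          _ = c * (P.real (fourArmTwoClusters r ρ) * P.real (fourArmTwoClusters ρ R)) := by
              rw [mul_one]
          _ ≤ P.real (fourArmTwoClusters r R) := hsp r ρ R hr h₁₂ h₂₃
      · -- `A r ≤ ρ`, `R < A ρ`, `A² r ≤ R`: move the middle radius down to `ρ' = ⌊R / A⌋`
        set ρ' : ℕ := R / A with hρ'
        have hAρ' : A * ρ' ≤ R := by rw [hρ', Nat.mul_comm]; exact Nat.div_mul_le_self R A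
        have hrρ' : A * r ≤ ρ' := by
          rw [hρ', Nat.le_div_iff_mul_le hA0]
          calc A * r * A = A * (A * r) := by ring
            _ ≤ R := h3
        have hρ'ρ : ρ' ≤ ρ := by
          rw [hρ']
          exact ((Nat.div_lt_iff_lt_mul hA0).2 (by rw [Nat.mul_comm]; exact h₂₃)).le
        have hAr1 : 1 ≤ A * r := le_trans (by omega) (Nat.mul_le_mul hA hr)
        have hρ'1 : 1 ≤ ρ' := hAr1.trans hrρ'
        have hRρ' : R ≤ A * (A * ρ') := by
          have hlt : R < A * (ρ' + 1) := by
            have h1 := Nat.div_add_mod R A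
            have h2 := Nat.mod_lt R hA0
            calc R = A * (R / A) + R % A := h1.symm
              _ < A * (R / A) + A := by omega
              _ = A * (ρ' + 1) := by rw [hρ']; ring
          calc R ≤ A * (ρ' + 1) := hlt.le
            _ ≤ A * (A * ρ') := Nat.mul_le_mul_left _ (by
                calc ρ' + 1 ≤ ρ' + ρ' := by omega
                  _ = 2 * ρ' := by ring
                  _ ≤ A * ρ' := Nat.mul_le_mul_right _ hA)
        have hmono : P.real (fourArmTwoClusters r ρ) ≤ P.real (fourArmTwoClusters r ρ') :=
          real_fourArmTwoClusters_mono half le_rfl ((Nat.le_mul_of_pos_left r hA0).trans hrρ') hρ'ρ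
        have hbr : a₁ ≤ P.real (fourArmTwoClusters ρ' R) :=
          hbd' ρ' R hρ'1 ((Nat.le_mul_of_pos_left ρ' hA0).trans hAρ') hRρ'
        calc c₁ * a₁ * (P.real (fourArmTwoClusters r ρ) * P.real (fourArmTwoClusters ρ R))
            ≤ c₁ * a₁ * (P.real (fourArmTwoClusters r ρ') * 1) := by
              refine mul_le_mul_of_nonneg_left ?_ (by positivity)
              exact mul_le_mul hmono (X1 _ _) (X0 _ _) (X0 _ _)
          _ = c₁ * (P.real (fourArmTwoClusters r ρ') * a₁) := by ring
          _ ≤ c * (P.real (fourArmTwoClusters r ρ') * P.real (fourArmTwoClusters ρ' R)) :=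
              mul_le_mul hc₁c (mul_le_mul_of_nonneg_left hbr (X0 _ _))
                (mul_nonneg (X0 _ _) ha₁0.le) hc.le
          _ ≤ P.real (fourArmTwoClusters r R) := hsp r ρ' R hr hrρ' hAρ'
    · -- `ρ < A r`, `A² r ≤ R`: move the middle radius up to `ρ'' = A r`
      have h₂₃ : A * (A * r) ≤ R := h3
      have hρ'' : ρ ≤ A * r := h₁₂.le
      have hArR : A * r ≤ R := le_trans (Nat.le_mul_of_pos_left _ hA0) h₂₃
      have hmono : P.real (fourArmTwoClusters ρ R) ≤ P.real (fourArmTwoClusters (A * r) R) :=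
        real_fourArmTwoClusters_mono half hρ'' hArR le_rfl
      have hbr : a₁ ≤ P.real (fourArmTwoClusters r (A * r)) :=
        hbd' r (A * r) hr (Nat.le_mul_of_pos_left _ hA0) (Nat.le_mul_of_pos_left _ hA0)
      calc c₁ * a₁ * (P.real (fourArmTwoClusters r ρ) * P.real (fourArmTwoClusters ρ R))
          ≤ c₁ * a₁ * (1 * P.real (fourArmTwoClusters (A * r) R)) := by
            refine mul_le_mul_of_nonneg_left ?_ (by positivity)
            exact mul_le_mul (X1 _ _) hmono (X0 _ _) zero_le_one
        _ = c₁ * (a₁ * P.real (fourArmTwoClusters (A * r) R)) := by ring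
        _ ≤ c * (P.real (fourArmTwoClusters r (A * r)) * P.real (fourArmTwoClusters (A * r) R)) :=
            mul_le_mul hc₁c (mul_le_mul_of_nonneg_right hbr (X0 _ _))
              (mul_nonneg ha₁0.le (X0 _ _)) hc.le
        _ ≤ P.real (fourArmTwoClusters r R) := hsp r (A * r) R hr le_rfl h₂₃
  -- move the constant to the right-hand side
  refine ⟨1 / (c₁ * a₁), by positivity, fun r ρ R hr hrρ hρR => ?_⟩
  have hk := key r ρ R hr hrρ hρR
  have hpos : 0 < c₁ * a₁ := mul_pos hc₁0 ha₁0
  rw [mul_comm (c₁ * a₁)] at hk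
  rw [one_div, ← div_eq_inv_mul, le_div_iff₀ hpos]
  exact hk

/-- **`DuminilCopinManolescuTassion2021_zdFourArm_quasiMult` from its well-spaced case and the
four-arm lower bound.** With the bounded-ratio positivity taken from the sibling fact
`DuminilCopinManolescuTassion2021_zdFourArm_lowerBound` (DMT 2021, Prop. 6.8, `q = 1`), the named
fact reduces to quasi-multiplicativity along well-spaced radii `A r ≤ ρ`, `A ρ ≤ R` (`r ≥ 1`) for
one ratio `A ≥ 2` — the content of Kesten's arm separation (outer boundary of `A_{r,ρ}`, inner
boundary of `A_{ρ,R}`) and gluing for bond percolation on `ℤ²`.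
[cite: DuminilCopinManolescuTassion2021, §6.2 Prop. 6.3, proof ("the same lines as for q = 2": separation + gluing)]
[cite: Nolin2008, §4.5 Prop. 17, proof (arXiv 0711.4948: Prop. 16)] -/
theorem DuminilCopinManolescuTassion2021_zdFourArm_quasiMult_of_spaced_of_lowerBound
    (hlb : DuminilCopinManolescuTassion2021_zdFourArm_lowerBound) {A : ℕ} (hA : 2 ≤ A)
    (hsp : ∃ c : ℝ, 0 < c ∧ ∀ r ρ R : ℕ, 1 ≤ r → A * r ≤ ρ → A * ρ ≤ R →
      c * ((bondPercolation (zdGraph 2) half).real (fourArmTwoClusters r ρ) *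
          (bondPercolation (zdGraph 2) half).real (fourArmTwoClusters ρ R)) ≤
        (bondPercolation (zdGraph 2) half).real (fourArmTwoClusters r R)) :
    DuminilCopinManolescuTassion2021_zdFourArm_quasiMult := by
  obtain ⟨a, ha, h⟩ := exists_pos_le_real_fourArmTwoClusters_of_lowerBound hlb
    (B := A * A) (le_trans (by norm_num) (Nat.mul_le_mul hA hA))
  exact zdFourArm_quasiMult_of_spaced hA
    ⟨a, ha, 1, fun m N hm hmN hN => h m N hm hmN (by rw [Nat.mul_assoc]; exact hN)⟩ hsp

/-! ### The four-arm lower bound from a five-arm lower bound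

Appended (literature-prover, `provefact` unit for
`DuminilCopinManolescuTassion2021_zdFourArm_lowerBound`): the sibling fact of this file's subject,
`DuminilCopinManolescuTassion2021_zdFourArm_lowerBound` (`ZdFourArmQuasiMult.lean`; DMT 2021,
Prop. 6.8 at `q = 1`: `φ[A_{1010}(r,R)] ≥ c₁₂ (r/R)^{2-c₁₂}` for all `R ≥ r ≥ 1`), is reduced to
a five-arm lower bound at well-spaced radii, `c (r/R)² ≤ P_{1/2}(𝒜₅(A_{r,R}))` for `r ≥ 1`,
`R ≥ A r` (DMT 2021, Prop. 6.6, first display, lower half; Nolin 2008, Thm. 24 (ii)), by the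
tree's PROVED Reimer step `zdFourArm_lowerBound_of_fiveArm_of_le_half`
(`ZdFourArmAPrioriLowerBound.lean`: `𝒜₅ ⊆ 𝒜₄ □ 𝒜₁`, Reimer's inequality, and the one-arm bound
`π₁(m,n) ≤ C (m/n)^α`, i.e. Nolin 2008, proof of Cor. 36 [arXiv 0711.4948: Cor. 35]: "we use the
a-priori bound for `4` arms given by the `5`-arm exponent:
`π₄(L',L) ≥ (L'/L)^{-α'} π₅(L',L) ≥ C (L'/L)^{2-α'}`"; DMT 2021, after Prop. 6.8: "That the
probability of the four-arm event is polynomially larger than that of the five-arm event, that is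
than `(r/R)²`, is a standard consequence of [RSW]"), plus the bounded-ratio radii `R < A r` (and
`R = r`) by monotonicity of the four-arm event in its outer radius (`real_fourArmTwoClusters_mono`).
The five-arm bound is a displayed hypothesis here (no named fact is introduced); it is the subject
of the layers `ZdBottomCluster.lean`, `ZdFiveArmColumn*.lean`, `ZdFiveArmCounting.lean`,
`ZdFiveArmDuality.lean`. -/

/-- **`DuminilCopinManolescuTassion2021_zdFourArm_lowerBound` from a five-arm lower bound at
well-spaced radii** (Nolin 2008, proof of Cor. 36 [arXiv 0711.4948: Cor. 35]; Werner 2009,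
Lecture 6, §3, third a priori estimate; DMT 2021, remark after Prop. 6.8).  If for some ratio
`A ≥ 1` and constant `c > 0` one has `c (r/R)² ≤ P_{1/2}(𝒜₅(A_{r,R}))` whenever `1 ≤ r` and
`A r ≤ R`, then the named fact holds: for `A r ≤ R`, `r < R` the tree's
`zdFourArm_lowerBound_of_fiveArm_of_le_half` gives `c₀ c (r/R)^{2-β} ≤ P_{1/2}(𝒜₄(A_{r,R}))`; for
`R < A' r` with `A' = max A 2` (which covers `R = r`),
`P(𝒜₄(A_{r,R})) ≥ P(𝒜₄(A_{r,A'r})) ≥ c₀ c (1/A')^{2-β}`; the single constant is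
`min (min β (c₀ c)) (min (c₀ c (1/A')^{2-β}) 1)`, using `(r/R)^{2-c'} ≤ (r/R)^{2-β}` for
`c' ≤ β` and `(r/R)^{2-c'} ≤ 1` for `c' ≤ 1` (`r ≤ R`).
[cite: Nolin2008, §7.4, proof of Cor. 36 (arXiv 0711.4948: Cor. 35)]
[cite: DuminilCopinManolescuTassion2021, §6.3, Prop. 6.8 and the remark following it (q = 1)] -/
theorem DuminilCopinManolescuTassion2021_zdFourArm_lowerBound_of_fiveArm_lowerBound {A : ℕ}
    (hA : 1 ≤ A) {c : ℝ} (hc : 0 < c)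
    (h5 : ∀ r R : ℕ, 1 ≤ r → A * r ≤ R →
      c * ((r : ℝ) / R) ^ 2 ≤ (bondPercolation (zdGraph 2) half).real (zdFiveArmClusters r R)) :
    DuminilCopinManolescuTassion2021_zdFourArm_lowerBound := by
  obtain ⟨c₀, β, hc₀, hβ, h4⟩ := zdFourArm_lowerBound_of_fiveArm_of_le_half
  set P := bondPercolation (zdGraph 2) half with hP
  have hhalf : ((half : unitInterval) : ℝ) ≤ 1 / 2 := by rw [coe_half]
  -- the five-arm bound in real-exponent form
  have h5' : ∀ r R : ℕ, 1 ≤ r → A * r ≤ R →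
      c * ((r : ℝ) / R) ^ (2 : ℝ) ≤ P.real (zdFiveArmClusters r R) := by
    intro r R hr hR
    have : ((r : ℝ) / R) ^ (2 : ℝ) = ((r : ℝ) / R) ^ (2 : ℕ) := by
      rw [← Real.rpow_natCast]
      norm_num
    rw [this]
    exact h5 r R hr hR
  -- well-spaced radii `A r ≤ R`, `r < R`: Reimer's step
  have hlt : ∀ r R : ℕ, 1 ≤ r → A * r ≤ R → r < R →
      c₀ * c * ((r : ℝ) / R) ^ (2 - β) ≤ P.real (fourArmTwoClusters r R) :=
    fun r R hr hAR hrR => h4 half hhalf c r R hr hrR (h5' r R hr hAR)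
  -- bounded ratio: shrink the outer radius of `A_{r, A' r}`, `A' = max A 2`
  set A' : ℕ := max A 2 with hA'
  have hA'2 : 2 ≤ A' := le_max_right _ _
  have hAA' : A ≤ A' := le_max_left _ _
  have hA'0 : (0 : ℝ) < A' := by exact_mod_cast (show 0 < A' by omega)
  have hbd : ∀ r R : ℕ, 1 ≤ r → r ≤ R → R ≤ A' * r →
      c₀ * c * (1 / (A' : ℝ)) ^ (2 - β) ≤ P.real (fourArmTwoClusters r R) := by
    intro r R hr hrR hRA
    have hq : ((r : ℝ) / ((A' * r : ℕ) : ℝ)) = 1 / A' := by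
      have hr0 : (r : ℝ) ≠ 0 := by exact_mod_cast (show r ≠ 0 by omega)
      rw [Nat.cast_mul]
      field_simp
    calc c₀ * c * (1 / (A' : ℝ)) ^ (2 - β)
        = c₀ * c * ((r : ℝ) / ((A' * r : ℕ) : ℝ)) ^ (2 - β) := by rw [hq]
      _ ≤ P.real (fourArmTwoClusters r (A' * r)) :=
          hlt r (A' * r) hr (Nat.mul_le_mul_right _ hAA') (by nlinarith)
      _ ≤ P.real (fourArmTwoClusters r R) := real_fourArmTwoClusters_mono half le_rfl hrR hRA
  set c' : ℝ := min (min β (c₀ * c)) (min (c₀ * c * (1 / (A' : ℝ)) ^ (2 - β)) 1) with hc'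
  have hc'β : c' ≤ β := (min_le_left _ _).trans (min_le_left _ _)
  have hc'c : c' ≤ c₀ * c := (min_le_left _ _).trans (min_le_right _ _)
  have hc'A : c' ≤ c₀ * c * (1 / (A' : ℝ)) ^ (2 - β) := (min_le_right _ _).trans (min_le_left _ _)
  have hc'1 : c' ≤ 1 := (min_le_right _ _).trans (min_le_right _ _)
  have hc'pos : 0 < c' :=
    lt_min (lt_min hβ (mul_pos hc₀ hc)) (lt_min (by positivity) one_pos)
  refine ⟨c', hc'pos, fun r R hr hrR => ?_⟩
  have hR0 : (0 : ℝ) < R := by exact_mod_cast (show 0 < R by omega)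
  have hx0 : 0 < (r : ℝ) / R := by
    have : (0 : ℝ) < r := by exact_mod_cast hr
    positivity
  have hx1 : (r : ℝ) / R ≤ 1 := by
    rw [div_le_one hR0]; exact_mod_cast hrR
  rcases le_or_gt (A' * r) R with hAR | hAR
  · -- well spaced (`A' ≥ 2` forces `r < R`)
    have hrR' : r < R := by
      calc r < 2 * r := by omega
        _ ≤ A' * r := Nat.mul_le_mul_right _ hA'2
        _ ≤ R := hAR
    calc c' * ((r : ℝ) / R) ^ (2 - c') ≤ c₀ * c * ((r : ℝ) / R) ^ (2 - β) :=
          mul_le_mul hc'c (Real.rpow_le_rpow_of_exponent_ge hx0 hx1 (by linarith))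
            (Real.rpow_nonneg hx0.le _) (mul_pos hc₀ hc).le
      _ ≤ P.real (fourArmTwoClusters r R) :=
          hlt r R hr ((Nat.mul_le_mul_right _ hAA').trans hAR) hrR'
  · -- bounded ratio
    calc c' * ((r : ℝ) / R) ^ (2 - c') ≤ c' * 1 := by
          refine mul_le_mul_of_nonneg_left ?_ hc'pos.le
          exact Real.rpow_le_one hx0.le hx1 (by linarith)
      _ = c' := mul_one _
      _ ≤ c₀ * c * (1 / (A' : ℝ)) ^ (2 - β) := hc'A
      _ ≤ P.real (fourArmTwoClusters r R) := hbd r R hr hrR hAR.le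

/-! ### The discharge -/

/-- **Discharge of `DuminilCopinManolescuTassion2021_zdFourArm_lowerBound`**: the a priori
four-arm lower bound `c (r/R)^{2-c} ≤ P_{1/2}(fourArmTwoClusters r R)` (`1 ≤ r ≤ R`) for critical
bond percolation on `ℤ²` (Duminil-Copin–Manolescu–Tassion 2021, Prop. 6.8 at `q = 1`; Nolin 2008,
§8.1), from the PROVED five-arm lower bound `zdFiveArm_lowerBound_two_radii'`
(`ZdFiveArmLowerBound.lean`: Nolin's lowest-crossing construction, rendered for bond-`ℤ²` in
`ZdLowestFrontier*.lean`, `ZdFiveArmVertex.lean`, `ZdFiveArmEnvironment.lean`) through the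
reduction `DuminilCopinManolescuTassion2021_zdFourArm_lowerBound_of_fiveArm_lowerBound` (Reimer's
step `π₅ ≤ π₄ · π₁`, the one-arm decay, small and moderate ratios by positivity).
[cite: DuminilCopinManolescuTassion2021, §6.3 Prop. 6.8 (four-arm lower bound), q = 1 (arXiv 2007.14707 numbering)] [cite: Nolin2008, §5.2 Thm. 24 (ii) and §8.1 (arXiv 0711.4948: Thm. 23 (ii))] -/
theorem DuminilCopinManolescuTassion2021_zdFourArm_lowerBound_holds :
    DuminilCopinManolescuTassion2021_zdFourArm_lowerBound := by
  obtain ⟨c, hc, h5⟩ := zdFiveArm_lowerBound_two_radii'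
  exact DuminilCopinManolescuTassion2021_zdFourArm_lowerBound_of_fiveArm_lowerBound (A := 1) le_rfl hc h5

end Literature.Probability.Percolation

end
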